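import Summits.QuantumAdvantage.QuantumAdvantage.Theorems.CubicForrelationNearExactIsExactTwelveLevelSixCrossCoset

/-!
# Crux `CubicForrelation.NearExactIsExact` (stmt-QuantumAdvantage-14043) — n = 12, level ≥ 6 AT `Φ = 59/64`: transversal directions whose
  translates AVOID a sparse two-coset exception (combinatorial lemma for the avoidance localisation)

Certificate seat `b2b-cforr-cert` (gen 15).  HONEST FRAMING: a purely combinatorial lemma (standard axioms) about cosets of a 512-element
xor-closed `V₀ ⊂ 𝔽₂¹²`, feeding `tw15_H34_avoid` (`…TwelveLevelSixH34Avoid.lean`); finite-slice bookkeeping, NOT summit progress.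

`tw15_avoid_dirs`: `S = x_Z ⊕ V₀`; two further cosets `y₁ ⊕ V₀ ≠ y₂ ⊕ V₀` (both `≠ S`) carry "bad" sets `B₁, B₂` of at most `31` points each,
and a point is GOOD if it lies off `S ∪ (y₁ ⊕ V₀) ∪ (y₂ ⊕ V₀)`, or in `yᵢ ⊕ V₀ ∖ Bᵢ`.  Then for every parametrised `k`-flat inside `S`
(`2^k ≤ 16`) there are directions `t₁, t₂, t₃` such that all seven translates of the flat by the non-zero elements of `⟨t₁, t₂, t₃⟩` consist of
good points (the shape consumed by `ep_loc3`).  Choice: `t₁ ∈ x_Z ⊕ y₁ ⊕ V₀` outside the `≤ 16·31 < 512` translates of `B₁` by flat points,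
`t₂` likewise for `y₂`, and `t₃` outside the four cosets `V₀, x_Z ⊕ y₁ ⊕ V₀, x_Z ⊕ y₂ ⊕ V₀, y₁ ⊕ y₂ ⊕ V₀` (`fl1_avoid`); the seven translates
then land in `y₁ ⊕ V₀` (avoiding `B₁`), `y₂ ⊕ V₀` (avoiding `B₂`) and five cosets different from `S, y₁ ⊕ V₀, y₂ ⊕ V₀`.

References: MacWilliams–Sloane (1977) Ch. 13 §3 (cosets of linear codes).  Everything below is proved from Mathlib and the tree; axioms are
the standard three.
-/

set_option linter.dupNamespace false -- D-0017: single-problem summit ⇒ `QuantumAdvantage.QuantumAdvantage` by design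

noncomputable section

namespace Summit.QuantumAdvantage.QuantumAdvantage.Theorems.CubicForrelation.NearExactIsExact

open Finset
open Literature.Computability.QuantumComplexity
open Literature.Computability.QuantumComplexity.BuzetChailloux (bxor zeroVec bxor_bxor_cancel_left bxor_zeroVec zeroVec_bxor bxor_comm
  bxor_self)

/-! ### Good translates by avoidance -/

/-- **Transversal directions avoiding a sparse two-coset exception.**  See the module docstring. [this work] -/
theorem tw15_avoid_dirs (V₀ S : Finset (Fin (6 + 6) → Bool)) (xZ y₁ y₂ : Fin (6 + 6) → Bool) (h0 : zeroVec ∈ V₀)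
    (hadd : ∀ a ∈ V₀, ∀ b ∈ V₀, bxor a b ∈ V₀) (hcardV : #V₀ = 512) (hS : S = V₀.image (bxor xZ))
    (hy₁ : y₁ ∉ S) (hy₂ : y₂ ∉ S) (hy₁₂ : y₂ ∉ V₀.image (bxor y₁))
    (G : (Fin (6 + 6) → Bool) → Prop)
    (hG : ∀ y, y ∉ S → y ∉ V₀.image (bxor y₁) → y ∉ V₀.image (bxor y₂) → G y)
    (B₁ B₂ : Finset (Fin (6 + 6) → Bool))
    (hB₁ : ∀ y ∈ V₀.image (bxor y₁), y ∉ B₁ → G y) (hB₂ : ∀ y ∈ V₀.image (bxor y₂), y ∉ B₂ → G y)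
    (hc₁ : #B₁ ≤ 31) (hc₂ : #B₂ ≤ 31)
    {k : ℕ} (hk : 2 ^ k ≤ 16) (x : Fin (6 + 6) → Bool) (hx : x ∈ S) (a : Fin k → Fin (6 + 6) → Bool) (ha : ∀ i, a i ∈ V₀) :
    ∃ t₁ t₂ t₃ : Fin (6 + 6) → Bool, ∀ ε : Fin k → Bool,
      G (bxor (fun j => x j ^^ decide (Odd #(univ.filter fun i => ε i && a i j))) t₁) ∧
      G (bxor (fun j => x j ^^ decide (Odd #(univ.filter fun i => ε i && a i j))) t₂) ∧
      G (bxor (bxor (fun j => x j ^^ decide (Odd #(univ.filter fun i => ε i && a i j))) t₂) t₁) ∧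
      G (bxor (fun j => x j ^^ decide (Odd #(univ.filter fun i => ε i && a i j))) t₃) ∧
      G (bxor (bxor (fun j => x j ^^ decide (Odd #(univ.filter fun i => ε i && a i j))) t₃) t₁) ∧
      G (bxor (bxor (fun j => x j ^^ decide (Odd #(univ.filter fun i => ε i && a i j))) t₃) t₂) ∧
      G (bxor (bxor (bxor (fun j => x j ^^ decide (Odd #(univ.filter fun i => ε i && a i j))) t₃) t₂) t₁) := by
  classical
  set pt : (Fin k → Bool) → (Fin (6 + 6) → Bool) := fun ε => fun j => x j ^^ decide (Odd #(univ.filter fun i => ε i && a i j))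
    with hptdef
  have hPV : ∀ x, x ∈ S → ∀ a ∈ V₀, bxor x a ∈ S := fun x hx a ha => fl1_coset_vadd hadd hS hx ha
  have hpt : ∀ ε, pt ε ∈ S := fun ε => ws_flatPt_mem V₀ h0 (· ∈ S) hPV k x hx a ha ε
  -- shift invariance of membership in `V₀`
  have hshift : ∀ v ∈ V₀, ∀ z : Fin (6 + 6) → Bool, (bxor z v ∈ V₀ ↔ z ∈ V₀) := by
    intro v hv z
    constructor
    · intro h
      have h' := hadd _ h v hv
      rwa [iw_bxor_assoc, bxor_self, bxor_zeroVec] at h'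
    · intro h; exact hadd z h v hv
  -- coset membership criterion for translates of points of `S`
  have hcrit : ∀ q ∈ S, ∀ y w : Fin (6 + 6) → Bool, (bxor q w ∈ V₀.image (bxor y) ↔ bxor (bxor xZ y) w ∈ V₀) := by
    intro q hq y w
    rw [hS] at hq
    obtain ⟨vq, hvq, rfl⟩ := mem_image.1 hq
    constructor
    · intro h
      obtain ⟨v', hv', hv'e⟩ := mem_image.1 h
      have hw : w = bxor (bxor xZ vq) (bxor y v') := by
        rw [← bxor_bxor_cancel_left (bxor xZ vq) w, ← hv'e]
      have e1 : bxor (bxor xZ y) w = bxor vq v' := by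
        rw [hw]; funext j; simp only [bxor]; cases xZ j <;> cases y j <;> cases vq j <;> cases v' j <;> rfl
      rw [e1]; exact hadd vq hvq v' hv'
    · intro h
      refine mem_image.2 ⟨bxor vq (bxor (bxor xZ y) w), hadd vq hvq _ h, ?_⟩
      funext j; simp only [bxor]; cases xZ j <;> cases y j <;> cases vq j <;> cases w j <;> rfl
  have hcritS : ∀ q ∈ S, ∀ w : Fin (6 + 6) → Bool, (bxor q w ∈ S ↔ w ∈ V₀) := by
    intro q hq w
    have h := hcrit q hq xZ w
    rw [bxor_self, zeroVec_bxor, ← hS] at h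
    exact h
  -- basic non-memberships
  have n₁ : bxor xZ y₁ ∉ V₀ := fun h => hy₁ (by rw [hS]; exact mem_image.2 ⟨_, h, bxor_bxor_cancel_left xZ y₁⟩)
  have n₂ : bxor xZ y₂ ∉ V₀ := fun h => hy₂ (by rw [hS]; exact mem_image.2 ⟨_, h, bxor_bxor_cancel_left xZ y₂⟩)
  have n₁₂ : bxor y₁ y₂ ∉ V₀ := fun h => hy₁₂ (mem_image.2 ⟨_, h, bxor_bxor_cancel_left y₁ y₂⟩)
  -- good translates off the three special cosets
  have hgen : ∀ w : Fin (6 + 6) → Bool, w ∉ V₀ → bxor (bxor xZ y₁) w ∉ V₀ → bxor (bxor xZ y₂) w ∉ V₀ → ∀ ε, G (bxor (pt ε) w) := by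
    intro w hw hw1 hw2 ε
    refine hG _ (fun h => hw ((hcritS _ (hpt ε) w).1 h)) (fun h => hw1 ((hcrit _ (hpt ε) y₁ w).1 h))
      (fun h => hw2 ((hcrit _ (hpt ε) y₂ w).1 h))
  -- the choice of `t₁ ∈ x_Z ⊕ y₁ ⊕ V₀` avoiding the translates of `B₁`, and of `t₂`
  have hchoose : ∀ (y : Fin (6 + 6) → Bool) (B : Finset (Fin (6 + 6) → Bool)), #B ≤ 31 →
      ∃ t, bxor (bxor xZ y) t ∈ V₀ ∧ ∀ ε, bxor (pt ε) t ∉ B := by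
    intro y B hB
    set D := V₀.image (bxor (bxor xZ y)) with hD
    have hDcard : #D = 512 := by
      rw [hD, card_image_of_injective _ (fun a b h => by simpa using congrArg (bxor (bxor xZ y)) h), hcardV]
    set Bad := (univ : Finset (Fin k → Bool)).biUnion (fun ε => B.image (bxor (pt ε))) with hBad
    have hBadcard : #Bad < #D := by
      calc #Bad ≤ ∑ ε : Fin k → Bool, #(B.image (bxor (pt ε))) := card_biUnion_le
        _ ≤ ∑ ε : Fin k → Bool, #B := sum_le_sum fun ε _ => card_image_le
        _ = 2 ^ k * #B := by rw [sum_const, card_univ, Fintype.card_fun, Fintype.card_bool, Fintype.card_fin, smul_eq_mul]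
        _ ≤ 16 * 31 := Nat.mul_le_mul hk hB
        _ < #D := by rw [hDcard]; norm_num
    obtain ⟨t, htD, htB⟩ := exists_mem_notMem_of_card_lt_card hBadcard
    refine ⟨t, fl1_coset_diff hD htD, fun ε hmem => htB ?_⟩
    exact mem_biUnion.2 ⟨ε, mem_univ _, mem_image.2 ⟨_, hmem, bxor_bxor_cancel_left _ _⟩⟩
  obtain ⟨t₁, hu₁, ht₁B⟩ := hchoose y₁ B₁ hc₁
  obtain ⟨t₂, hu₂, ht₂B⟩ := hchoose y₂ B₂ hc₂
  -- the choice of `t₃` outside four cosets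
  obtain ⟨d, -, hd⟩ := fl1_avoid univ V₀ [zeroVec, bxor xZ y₁, bxor xZ y₂, bxor y₁ y₂] (by
    rw [hcardV, card_univ, Fintype.card_fun, Fintype.card_bool, Fintype.card_fin]; norm_num)
  have hd0 : d ∉ V₀ := by have h := hd zeroVec (by simp); rwa [zeroVec_bxor] at h
  have hd1 : bxor (bxor xZ y₁) d ∉ V₀ := hd _ (by simp)
  have hd2 : bxor (bxor xZ y₂) d ∉ V₀ := hd _ (by simp)
  have hd12 : bxor (bxor y₁ y₂) d ∉ V₀ := hd _ (by simp)
  -- write `t₁ = (x_Z ⊕ y₁) ⊕ u₁`, `t₂ = (x_Z ⊕ y₂) ⊕ u₂` with `u₁, u₂ ∈ V₀`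
  set u₁ := bxor (bxor xZ y₁) t₁ with hu₁def
  set u₂ := bxor (bxor xZ y₂) t₂ with hu₂def
  have et₁ : t₁ = bxor (bxor xZ y₁) u₁ := by rw [hu₁def, bxor_bxor_cancel_left]
  have et₂ : t₂ = bxor (bxor xZ y₂) u₂ := by rw [hu₂def, bxor_bxor_cancel_left]
  have hu₂₁ : bxor u₂ u₁ ∈ V₀ := hadd _ hu₂ _ hu₁
  -- membership transport along an identity `X = bxor Y v`, `v ∈ V₀`
  have htr : ∀ (X Y v : Fin (6 + 6) → Bool), v ∈ V₀ → X = bxor Y v → Y ∉ V₀ → X ∉ V₀ :=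
    fun X Y v hv hXY hY hX => hY ((hshift v hv Y).1 (hXY ▸ hX))
  refine ⟨t₁, t₂, d, fun ε => ⟨?_, ?_, ?_, ?_, ?_, ?_, ?_⟩⟩
  · -- `t₁`: translate in `y₁ ⊕ V₀`, outside `B₁`
    exact hB₁ _ ((hcrit _ (hpt ε) y₁ t₁).2 hu₁) (ht₁B ε)
  · exact hB₂ _ ((hcrit _ (hpt ε) y₂ t₂).2 hu₂) (ht₂B ε)
  · -- `t₂ ⊕ t₁`
    rw [iw_bxor_assoc]
    refine hgen (bxor t₂ t₁) ?_ ?_ ?_ ε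
    · refine htr _ (bxor y₁ y₂) (bxor u₂ u₁) hu₂₁ ?_ n₁₂
      rw [et₁, et₂]; funext j; simp only [bxor]
      cases xZ j <;> cases y₁ j <;> cases y₂ j <;> cases u₁ j <;> cases u₂ j <;> rfl
    · refine htr _ (bxor xZ y₂) (bxor u₂ u₁) hu₂₁ ?_ n₂
      rw [et₁, et₂]; funext j; simp only [bxor]
      cases xZ j <;> cases y₁ j <;> cases y₂ j <;> cases u₁ j <;> cases u₂ j <;> rfl
    · refine htr _ (bxor xZ y₁) (bxor u₂ u₁) hu₂₁ ?_ n₁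
      rw [et₁, et₂]; funext j; simp only [bxor]
      cases xZ j <;> cases y₁ j <;> cases y₂ j <;> cases u₁ j <;> cases u₂ j <;> rfl
  · -- `t₃ = d`
    exact hgen d hd0 hd1 hd2 ε
  · -- `d ⊕ t₁`
    rw [iw_bxor_assoc]
    refine hgen (bxor d t₁) ?_ ?_ ?_ ε
    · refine htr _ (bxor (bxor xZ y₁) d) u₁ hu₁ ?_ hd1
      rw [et₁]; funext j; simp only [bxor]
      cases xZ j <;> cases y₁ j <;> cases d j <;> cases u₁ j <;> rfl
    · refine htr _ d u₁ hu₁ ?_ hd0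
      rw [et₁]; funext j; simp only [bxor]
      cases xZ j <;> cases y₁ j <;> cases d j <;> cases u₁ j <;> rfl
    · refine htr _ (bxor (bxor y₁ y₂) d) u₁ hu₁ ?_ hd12
      rw [et₁]; funext j; simp only [bxor]
      cases xZ j <;> cases y₁ j <;> cases y₂ j <;> cases d j <;> cases u₁ j <;> rfl
  · -- `d ⊕ t₂`
    rw [iw_bxor_assoc]
    refine hgen (bxor d t₂) ?_ ?_ ?_ ε
    · refine htr _ (bxor (bxor xZ y₂) d) u₂ hu₂ ?_ hd2
      rw [et₂]; funext j; simp only [bxor]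
      cases xZ j <;> cases y₂ j <;> cases d j <;> cases u₂ j <;> rfl
    · refine htr _ (bxor (bxor y₁ y₂) d) u₂ hu₂ ?_ hd12
      rw [et₂]; funext j; simp only [bxor]
      cases xZ j <;> cases y₁ j <;> cases y₂ j <;> cases d j <;> cases u₂ j <;> rfl
    · refine htr _ d u₂ hu₂ ?_ hd0
      rw [et₂]; funext j; simp only [bxor]
      cases xZ j <;> cases y₂ j <;> cases d j <;> cases u₂ j <;> rfl
  · -- `d ⊕ t₂ ⊕ t₁`
    rw [iw_bxor_assoc, iw_bxor_assoc]
    refine hgen (bxor d (bxor t₂ t₁)) ?_ ?_ ?_ ε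
    · refine htr _ (bxor (bxor y₁ y₂) d) (bxor u₂ u₁) hu₂₁ ?_ hd12
      rw [et₁, et₂]; funext j; simp only [bxor]
      cases xZ j <;> cases y₁ j <;> cases y₂ j <;> cases d j <;> cases u₁ j <;> cases u₂ j <;> rfl
    · refine htr _ (bxor (bxor xZ y₂) d) (bxor u₂ u₁) hu₂₁ ?_ hd2
      rw [et₁, et₂]; funext j; simp only [bxor]
      cases xZ j <;> cases y₁ j <;> cases y₂ j <;> cases d j <;> cases u₁ j <;> cases u₂ j <;> rfl
    · refine htr _ (bxor (bxor xZ y₁) d) (bxor u₂ u₁) hu₂₁ ?_ hd1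
      rw [et₁, et₂]; funext j; simp only [bxor]
      cases xZ j <;> cases y₁ j <;> cases y₂ j <;> cases d j <;> cases u₁ j <;> cases u₂ j <;> rfl

end Summit.QuantumAdvantage.QuantumAdvantage.Theorems.CubicForrelation.NearExactIsExact

end
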